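import Literature.AlgebraicGeometry.ModuliOfAbelianVarieties.SiegelFamilyHumbertCMPoints
import HarnessLib

/-!
# Simple and non-simple points of `H_q ∩ H_{q′}`: `X_Z` is simple iff `ρ(X_Z) = 3` and the discriminant form
# `S_Δ` does not represent a non-zero square (Runge 1999 §6, p. 296 and Remark 14)

Layer `Literature/AlgebraicGeometry/ModuliOfAbelianVarieties`, namespace
`Literature.AlgebraicGeometry.ModuliOfAbelianVarieties.SiegelModuli`; lane `lit-hodgefound` (Track 2 foundations
library, Layer A4), seat `lit-hodgefound-skel-4`, row **A4-66**, FILE 5: junction of FILE 1 (the binary form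
`Δ(xq + yq′) = x²Δ(q) + 2xyΔ(q,q′) + y²Δ(q′) = S_Δ[x, y]`), FILE 4 (`ρ(X_Z) = 4 ⟹ X_Z` not simple; on two
independent Humbert surfaces `ρ ∈ {3, 4}`), A4-65 FILE 5 (`ρ(X_Z) = dim_ℚ W_Z + 1`) and row A4-62
`SiegelFamilyHumbertSquareInvariant` (B–W Prop. 4.8 / 4.9 (1): `X_Z` is not simple iff `Z ∈ H_r` for some `r ≠ 0` of
square invariant `Δ(r) = δ²`).

## Source, verbatim

B. Runge, *Endomorphism rings of abelian surfaces and projective models of their moduli spaces*, Tohoku Math. J. 51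
(1999), §6 p. 296 (held `paper:doi-10-2748-tmj-1178224764` p0014): "DEFINITION. A QCM-curve `C_R` is called simple if
almost all of its points are simple QCM-points. From part (iii) of the theorem above it follows that if the
discriminant form of an QCM-order `R` represents a non-zero square, all period points correspond to non-simple abelian
surfaces with multiplication by `R`. If `C_R` is a non-simple QCM-curve, then all non-simple QCM-points on `C_R`
different from CM-points have the same quaternionic multiplication. There cannot be any simple CM-point on a
QCM-curve." — and Remark 14 (p. 297): "A class is simple if it does not represent non-zero squares."

Here the "discriminant form" of the pair `(q, q′)` is the binary form `S_Δ[x, y] = x²Δ(q) + 2xyΔ(q,q′) + y²Δ(q′) =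
Δ(xq + yq′)` (FILE 1 `humbertInvariant_add_smul_smul`), and a point `Z ∈ H_q ∩ H_{q′}` with `ρ(X_Z) = 3` has
`W_Z = ℚq ⊕ ℚq′` (A4-65 FILE 5), so EVERY singular relation of `Z` is a rational combination of `q, q′`.

## What is proved (theorems only; NO definition, NO named fact, net debt 0)

* §1 **`not_isSimple_of_humbertInvariant_smul_add_smul_eq_sq`** (for `Z ∈ H_q ∩ H_{q′}`: if `Δ(xq + yq′) = δ² ≠ 0`
  for integers `x, y` then `X_Z` is NOT simple — `Z ∈ H_{xq+yq′}` of square invariant, B–W Prop. 4.8), the same with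
  the form written out **`not_isSimple_of_discForm_eq_sq`** (`x²Δ(q) + 2xyΔ(q,q′) + y²Δ(q′) = δ² ≠ 0`): Runge's "if the
  discriminant form represents a non-zero square, all period points correspond to non-simple abelian surfaces".
* §2 (independent `q, q′`, `ρ(X_Z) = 3`) `ratRelSpace_eq_span_pair_of_finrank_eq_three` (`W_Z = span_ℚ{q, q′}`),
  `exists_rat_of_mem_humbertLocus_of_finrank_eq_three` (every integer relation `r` of `Z` is `xq + yq′`, `x, y ∈ ℚ`),
  **`exists_discForm_eq_sq_of_not_isSimple`** (if `X_Z` is not simple then `S_Δ` represents a non-zero square OVER `ℤ`: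
  the square-invariant relation of the elliptic curve lies in `W_Z = ℚq + ℚq′`; clear denominators), and the criterion
  **`not_isSimple_iff_exists_discForm_eq_sq`** / **`isSimple_iff_forall_discForm_ne_sq`** (`ρ(X_Z) = 3`: `X_Z` simple iff
  `S_Δ` represents no non-zero square — Remark 14's "simple class").
* §4 (independent `q, q′`, `ρ(X_Z) = 3`) **`endAlgRat_eq_humbertPairAlg_of_finrank_eq_three`** (`End_ℚ(X_Z) = ℚ(α, β)`
  at EVERY non-CM point of the intersection, simple or not), `eq_zero_or_eq_zero_of_mul_eq_zero_of_isSimple`,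
  `exists_mul_eq_zero_of_not_isSimple`, **`isSimple_iff_forall_mul_eq_zero_of_finrank_eq_three`** (`X_Z` simple iff
  `ℚ(α, β)` has no zero-divisors), **`isSimple_iff_finrank_eq_three_and_forall_mul_eq_zero`**, and the by-product
  `exists_discForm_eq_sq_iff_exists_mul_eq_zero` (`S_Δ` represents a non-zero square iff `ℚ(α, β)` has zero-divisors).
* §3 (independent `q, q′`, any `ρ`) **`isSimple_iff_of_mem_inter`**: `X_Z` is simple iff `ρ(X_Z) = 3` AND `S_Δ`
  represents no non-zero square (`ρ = 4`, the CM points, are never simple — FILE 4; "there cannot be any simple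
  CM-point on a QCM-curve").

## Scope

Pointwise statements on `𝔥₂` (no QCM-curve `C_R` as a subvariety, no "almost all points"); the form is represented
over `ℤ` (equivalently over `ℚ`, by homogeneity).

## References

* [Runge1999EndomorphismRingsAbelianSurfaces] B. Runge, Tohoku Math. J. 51 (1999), §6 Thm. 9 (iii), Definition and
  discussion p. 296, Remark 14 p. 297.
* [BirkenhakeWilhelm2003] Ch. Birkenhake, H. Wilhelm (2003), §4 Prop. 4.8, Prop. 4.9 (1), (3).
-/

noncomputable section

open Matrix Module Function

namespace Literature.AlgebraicGeometry.ModuliOfAbelianVarieties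

namespace SiegelModuli

open Literature.NumberTheory.Automorphic (siegelUpperHalfSpace)
open Literature.NumberTheory.ModularForms.SiegelUpperHalfSpace
open Literature.Geometry.Kaehler Literature.Geometry.Kaehler.ComplexTorus

variable {q q' : Fin 5 → ℤ} {Z : siegelUpperHalfSpace 2}

/-! ## §1 A non-zero square represented by `S_Δ` forces an elliptic curve -/

section Square

/-- `H_q ∩ H_{q′} ⊆ H_{xq + yq′}`: integer combinations of relations of `Z` are relations of `Z`.
[cite: BirkenhakeWilhelm2003, §4 eq. (11) (p. 1830)] -/
theorem mem_humbertLocus_smul_add_smul (h₀ : Z ∈ humbertLocus (fun i ↦ (q i : ℂ)))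
    (h₁ : Z ∈ humbertLocus (fun i ↦ (q' i : ℂ))) (x y : ℤ) :
    Z ∈ humbertLocus (fun i ↦ ((x • q + y • q') i : ℂ)) := by
  rw [mem_humbertLocus_iff] at h₀ h₁ ⊢
  have hc : (fun i ↦ (((x • q + y • q') i : ℤ) : ℂ)) = (x : ℂ) • (fun i ↦ (q i : ℂ)) + (y : ℂ) • (fun i ↦ (q' i : ℂ)) := by
    funext i
    simp only [Pi.add_apply, Pi.smul_apply, smul_eq_mul, Int.cast_add, Int.cast_mul]
  rw [hc, singularRelation_add, singularRelation_smul, singularRelation_smul, h₀, h₁, mul_zero, mul_zero, add_zero]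

/-- **Runge, p. 296: if the discriminant form represents a non-zero square, the period point is not simple.** For
`Z ∈ H_q ∩ H_{q′}` and integers `x, y` with `Δ(xq + yq′) = δ² ≠ 0`, the surface `X_Z` is not simple: `Z` lies on the
Humbert surface `H_{xq+yq′}` of square invariant, which carries an elliptic curve (row A4-62
`not_isSimple_of_mem_humbertLocus_of_sq`, B–W Prop. 4.8).
[cite: Runge1999EndomorphismRingsAbelianSurfaces, §6 Thm. 9 (iii) and p. 296] [cite: BirkenhakeWilhelm2003, §4 Prop. 4.8 (pp. 1830–1831)] -/
theorem not_isSimple_of_humbertInvariant_smul_add_smul_eq_sq (h₀ : Z ∈ humbertLocus (fun i ↦ (q i : ℂ)))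
    (h₁ : Z ∈ humbertLocus (fun i ↦ (q' i : ℂ))) {x y δ : ℤ} (hδ : δ ≠ 0)
    (hsq : humbertInvariant (x • q + y • q') = δ ^ 2) :
    ¬ IsSimple (prinPeriod Z : (Fin 2 ⊕ Fin 2 → ℝ) ≃L[ℝ] (Fin 2 → ℂ)) := by
  have hr : x • q + y • q' ≠ 0 := by
    intro h0
    have hΔ0 : humbertInvariant (0 : Fin 5 → ℤ) = 0 := by simp [humbertInvariant]
    rw [h0, hΔ0] at hsq
    exact hδ (pow_eq_zero_iff two_ne_zero |>.1 hsq.symm)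
  exact not_isSimple_of_mem_humbertLocus_of_sq Z hr (mem_humbertLocus_smul_add_smul h₀ h₁ x y) hsq

/-- The same with the form written out: **`x²Δ(q) + 2xyΔ(q,q′) + y²Δ(q′) = δ² ≠ 0` (integers) ⟹ `X_Z` not simple.**
[cite: Runge1999EndomorphismRingsAbelianSurfaces, §6 p. 296 and Remark 14 (p. 297)] [cite: BirkenhakeWilhelm2003, §4 Prop. 4.8 (pp. 1830–1831)] -/
theorem not_isSimple_of_discForm_eq_sq (h₀ : Z ∈ humbertLocus (fun i ↦ (q i : ℂ)))
    (h₁ : Z ∈ humbertLocus (fun i ↦ (q' i : ℂ))) {x y δ : ℤ} (hδ : δ ≠ 0)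
    (hsq : x ^ 2 * humbertInvariant q + 2 * x * y * humbertPolar q q' + y ^ 2 * humbertInvariant q' = δ ^ 2) :
    ¬ IsSimple (prinPeriod Z : (Fin 2 ⊕ Fin 2 → ℝ) ≃L[ℝ] (Fin 2 → ℂ)) :=
  not_isSimple_of_humbertInvariant_smul_add_smul_eq_sq h₀ h₁ hδ (by rw [humbertInvariant_add_smul_smul, hsq])

end Square

/-! ## §2 `ρ(X_Z) = 3`: every relation is a rational combination of `q, q′`; the converse -/

section RankThree

/-- **For `Z ∈ H_q ∩ H_{q′}` with independent `q, q′` and `ρ(X_Z) = 3`: `W_Z = ℚq ⊕ ℚq′`** (`dim W_Z = ρ − 1 = 2`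
and `q, q′ ∈ W_Z` are independent). [cite: BirkenhakeWilhelm2003, §4 eq. (11), (13), Prop. 4.9 (2) (pp. 1830–1831)] -/
theorem ratRelSpace_eq_span_pair_of_finrank_eq_three (h₀ : Z ∈ humbertLocus (fun i ↦ (q i : ℂ)))
    (h₁ : Z ∈ humbertLocus (fun i ↦ (q' i : ℂ)))
    (hli : LinearIndependent ℚ ![(fun i ↦ (q i : ℚ)), (fun i ↦ (q' i : ℚ))])
    (h3 : finrank ℤ (neronSeveriGroup (prinPeriod Z : (Fin 2 ⊕ Fin 2 → ℝ) ≃L[ℝ] (Fin 2 → ℂ))) = 3) :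
    ratRelSpace Z = Submodule.span ℚ (Set.range ![(fun i ↦ (q i : ℚ)), (fun i ↦ (q' i : ℚ))]) := by
  have hW : finrank ℚ (ratRelSpace Z) = 2 := by
    have h := finrank_hodgeClasses_one_eq_finrank_ratRelSpace_add_one Z
    rw [← finrank_neronSeveriGroup_eq_finrank_hodgeClasses, h3] at h
    omega
  have hle : Submodule.span ℚ (Set.range ![(fun i ↦ (q i : ℚ)), (fun i ↦ (q' i : ℚ))]) ≤ ratRelSpace Z := by
    rw [Submodule.span_le]
    rintro _ ⟨i, rfl⟩
    fin_cases i
    · exact intCast_mem_ratRelSpace_iff.2 h₀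
    · exact intCast_mem_ratRelSpace_iff.2 h₁
  have hS : finrank ℚ (Submodule.span ℚ (Set.range ![(fun i ↦ (q i : ℚ)), (fun i ↦ (q' i : ℚ))])) = 2 := by
    rw [finrank_span_eq_card hli, Fintype.card_fin]
  exact (Submodule.eq_of_le_of_finrank_eq hle (by rw [hS, hW])).symm

/-- **With `ρ(X_Z) = 3`, every integer relation `r` of `Z` is a rational combination `r = xq + yq′`.**
[cite: BirkenhakeWilhelm2003, §4 eq. (11), (13) (pp. 1830–1831)] [cite: Runge1999EndomorphismRingsAbelianSurfaces, §6 Thm. 7 (`R ⊗ ℚ = ℚ ⊕ ℚα ⊕ ℚβ ⊕ ℚαβ`)] -/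
theorem exists_rat_of_mem_humbertLocus_of_finrank_eq_three (h₀ : Z ∈ humbertLocus (fun i ↦ (q i : ℂ)))
    (h₁ : Z ∈ humbertLocus (fun i ↦ (q' i : ℂ)))
    (hli : LinearIndependent ℚ ![(fun i ↦ (q i : ℚ)), (fun i ↦ (q' i : ℚ))])
    (h3 : finrank ℤ (neronSeveriGroup (prinPeriod Z : (Fin 2 ⊕ Fin 2 → ℝ) ≃L[ℝ] (Fin 2 → ℂ))) = 3)
    {r : Fin 5 → ℤ} (hr : Z ∈ humbertLocus (fun i ↦ (r i : ℂ))) :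
    ∃ x y : ℚ, x • (fun i ↦ (q i : ℚ)) + y • (fun i ↦ (q' i : ℚ)) = fun i ↦ (r i : ℚ) := by
  have hmem : (fun i ↦ (r i : ℚ)) ∈ ratRelSpace Z := intCast_mem_ratRelSpace_iff.2 hr
  rw [ratRelSpace_eq_span_pair_of_finrank_eq_three h₀ h₁ hli h3, Submodule.mem_span_range_iff_exists_fun] at hmem
  obtain ⟨c, hc⟩ := hmem
  refine ⟨c 0, c 1, ?_⟩
  rw [← hc, Fin.sum_univ_two]
  rfl

/-- Clearing denominators: for rationals `x, y` there are integers `X, Y` and `N ≥ 1` with `N x = X`, `N y = Y`.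
[folklore] -/
private theorem exists_int_mul_eq (x y : ℚ) :
    ∃ (N : ℕ) (X Y : ℤ), 0 < N ∧ (N : ℚ) * x = X ∧ (N : ℚ) * y = Y := by
  refine ⟨x.den * y.den, x.num * y.den, y.num * x.den, Nat.mul_pos x.den_pos y.den_pos, ?_, ?_⟩
  · rw [Nat.cast_mul, Int.cast_mul, Int.cast_natCast, mul_comm (x.den : ℚ), mul_assoc, mul_comm (x.den : ℚ) x,
      Rat.mul_den_eq_num, mul_comm]
  · rw [Nat.cast_mul, Int.cast_mul, Int.cast_natCast, mul_assoc, mul_comm (y.den : ℚ) y, Rat.mul_den_eq_num, mul_comm]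

/-- **The converse for `ρ(X_Z) = 3` (Runge, p. 296, read pointwise): if `X_Z` is not simple then the discriminant
form represents a non-zero square over `ℤ`** — the elliptic curve gives a relation `r ≠ 0` of `Z` with `Δ(r) = δ²`,
`δ > 0` (row A4-62 / B–W Prop. 4.8); `r = xq + yq′` rationally (`W_Z = ℚq ⊕ ℚq′`); clearing denominators,
`S_Δ[Nx, Ny] = (Nδ)²`. [cite: Runge1999EndomorphismRingsAbelianSurfaces, §6 p. 296 and Remark 14 (p. 297)] [cite: BirkenhakeWilhelm2003, §4 Prop. 4.8, Prop. 4.9 (1) (pp. 1830–1831)] -/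
theorem exists_discForm_eq_sq_of_not_isSimple (h₀ : Z ∈ humbertLocus (fun i ↦ (q i : ℂ)))
    (h₁ : Z ∈ humbertLocus (fun i ↦ (q' i : ℂ)))
    (hli : LinearIndependent ℚ ![(fun i ↦ (q i : ℚ)), (fun i ↦ (q' i : ℚ))])
    (h3 : finrank ℤ (neronSeveriGroup (prinPeriod Z : (Fin 2 ⊕ Fin 2 → ℝ) ≃L[ℝ] (Fin 2 → ℂ))) = 3)
    (hX : ¬ IsSimple (prinPeriod Z : (Fin 2 ⊕ Fin 2 → ℝ) ≃L[ℝ] (Fin 2 → ℂ))) :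
    ∃ x y δ : ℤ, δ ≠ 0 ∧
      x ^ 2 * humbertInvariant q + 2 * x * y * humbertPolar q q' + y ^ 2 * humbertInvariant q' = δ ^ 2 := by
  obtain ⟨δ, hδ, hZδ⟩ := (not_isSimple_iff_exists_mem_humbertLocusOfInvariant_sq Z).1 hX
  obtain ⟨r, -, hΔr, hZr⟩ := mem_humbertLocusOfInvariant_iff.1 hZδ
  obtain ⟨x, y, hxy⟩ := exists_rat_of_mem_humbertLocus_of_finrank_eq_three h₀ h₁ hli h3 hZr
  -- `Δ` of the rational combination
  have hQ : x ^ 2 * ((humbertInvariant q : ℤ) : ℚ) + 2 * x * y * ((humbertPolar q q' : ℤ) : ℚ) +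
      y ^ 2 * ((humbertInvariant q' : ℤ) : ℚ) = ((δ : ℤ) : ℚ) ^ 2 := by
    rw [ratCast_humbertInvariant, ratCast_humbertInvariant, ratCast_humbertPolar, ← humbertInvariant_add_smul_smul, hxy,
      ← ratCast_humbertInvariant, hΔr, Int.cast_pow]
  obtain ⟨N, X, Y, hN, hX', hY'⟩ := exists_int_mul_eq x y
  refine ⟨X, Y, N * δ, mul_ne_zero (by exact_mod_cast hN.ne') hδ.ne', ?_⟩
  have hZ' : ((X ^ 2 * humbertInvariant q + 2 * X * Y * humbertPolar q q' + Y ^ 2 * humbertInvariant q' : ℤ) : ℚ) =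
      (((N * δ) ^ 2 : ℤ) : ℚ) := by
    push_cast
    rw [← hX', ← hY']
    linear_combination ((N : ℚ) ^ 2) * hQ
  exact_mod_cast hZ'

/-- **`ρ(X_Z) = 3` on `H_q ∩ H_{q′}`: `X_Z` is not simple iff the discriminant form `S_Δ` represents a non-zero square
over `ℤ`.** [cite: Runge1999EndomorphismRingsAbelianSurfaces, §6 p. 296 and Remark 14 (p. 297)] [cite: BirkenhakeWilhelm2003, §4 Prop. 4.8, Prop. 4.9 (pp. 1830–1831)] -/
theorem not_isSimple_iff_exists_discForm_eq_sq (h₀ : Z ∈ humbertLocus (fun i ↦ (q i : ℂ)))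
    (h₁ : Z ∈ humbertLocus (fun i ↦ (q' i : ℂ)))
    (hli : LinearIndependent ℚ ![(fun i ↦ (q i : ℚ)), (fun i ↦ (q' i : ℚ))])
    (h3 : finrank ℤ (neronSeveriGroup (prinPeriod Z : (Fin 2 ⊕ Fin 2 → ℝ) ≃L[ℝ] (Fin 2 → ℂ))) = 3) :
    ¬ IsSimple (prinPeriod Z : (Fin 2 ⊕ Fin 2 → ℝ) ≃L[ℝ] (Fin 2 → ℂ)) ↔
      ∃ x y δ : ℤ, δ ≠ 0 ∧
        x ^ 2 * humbertInvariant q + 2 * x * y * humbertPolar q q' + y ^ 2 * humbertInvariant q' = δ ^ 2 :=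
  ⟨exists_discForm_eq_sq_of_not_isSimple h₀ h₁ hli h3,
    fun ⟨_, _, _, hδ, hsq⟩ ↦ not_isSimple_of_discForm_eq_sq h₀ h₁ hδ hsq⟩

/-- **Remark 14's "simple class", pointwise: for `ρ(X_Z) = 3` on `H_q ∩ H_{q′}`, `X_Z` is simple iff `S_Δ` does not
represent a non-zero square.** [cite: Runge1999EndomorphismRingsAbelianSurfaces, §6 p. 296 and Remark 14 (p. 297)] -/
theorem isSimple_iff_forall_discForm_ne_sq (h₀ : Z ∈ humbertLocus (fun i ↦ (q i : ℂ)))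
    (h₁ : Z ∈ humbertLocus (fun i ↦ (q' i : ℂ)))
    (hli : LinearIndependent ℚ ![(fun i ↦ (q i : ℚ)), (fun i ↦ (q' i : ℚ))])
    (h3 : finrank ℤ (neronSeveriGroup (prinPeriod Z : (Fin 2 ⊕ Fin 2 → ℝ) ≃L[ℝ] (Fin 2 → ℂ))) = 3) :
    IsSimple (prinPeriod Z : (Fin 2 ⊕ Fin 2 → ℝ) ≃L[ℝ] (Fin 2 → ℂ)) ↔
      ∀ x y δ : ℤ, δ ≠ 0 →
        x ^ 2 * humbertInvariant q + 2 * x * y * humbertPolar q q' + y ^ 2 * humbertInvariant q' ≠ δ ^ 2 := by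
  rw [← not_iff_not, not_isSimple_iff_exists_discForm_eq_sq h₀ h₁ hli h3]
  simp only [not_forall, not_not, exists_prop]

end RankThree

/-! ## §3 The simplicity criterion on `H_q ∩ H_{q′}` -/

section Criterion

/-- **SIMPLICITY ON TWO INDEPENDENT HUMBERT SURFACES: `X_Z` is simple iff `ρ(X_Z) = 3` and the discriminant form
`S_Δ[x, y] = x²Δ(q) + 2xyΔ(q,q′) + y²Δ(q′)` represents no non-zero square over `ℤ`** (the CM points `ρ = 4` are never
simple: FILE 4; "There cannot be any simple CM-point on a QCM-curve").
[cite: Runge1999EndomorphismRingsAbelianSurfaces, §6 p. 296 and Remark 14 (p. 297)] [cite: BirkenhakeWilhelm2003, §4 Prop. 4.8, Prop. 4.9 (1), (3) (pp. 1830–1831)] -/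
theorem isSimple_iff_of_mem_inter (h₀ : Z ∈ humbertLocus (fun i ↦ (q i : ℂ)))
    (h₁ : Z ∈ humbertLocus (fun i ↦ (q' i : ℂ)))
    (hli : LinearIndependent ℚ ![(fun i ↦ (q i : ℚ)), (fun i ↦ (q' i : ℚ))]) :
    IsSimple (prinPeriod Z : (Fin 2 ⊕ Fin 2 → ℝ) ≃L[ℝ] (Fin 2 → ℂ)) ↔
      finrank ℤ (neronSeveriGroup (prinPeriod Z : (Fin 2 ⊕ Fin 2 → ℝ) ≃L[ℝ] (Fin 2 → ℂ))) = 3 ∧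
        ∀ x y δ : ℤ, δ ≠ 0 →
          x ^ 2 * humbertInvariant q + 2 * x * y * humbertPolar q q' + y ^ 2 * humbertInvariant q' ≠ δ ^ 2 := by
  constructor
  · intro hX
    have h3 : finrank ℤ (neronSeveriGroup (prinPeriod Z : (Fin 2 ⊕ Fin 2 → ℝ) ≃L[ℝ] (Fin 2 → ℂ))) = 3 := by
      rcases finrank_neronSeveriGroup_and_finrank_endAlgRat_of_mem_inter h₀ h₁ hli with ⟨h3, -⟩ | ⟨h4, -⟩
      · exact h3
      · exact absurd hX (not_isSimple_of_finrank_neronSeveriGroup_eq_four h4)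
    exact ⟨h3, (isSimple_iff_forall_discForm_ne_sq h₀ h₁ hli h3).1 hX⟩
  · rintro ⟨h3, h⟩
    exact (isSimple_iff_forall_discForm_ne_sq h₀ h₁ hli h3).2 h

/-- **The CM points are exactly the non-simple points NOT detected by `S_Δ`**: on `H_q ∩ H_{q′}`, if `X_Z` is not
simple but `S_Δ` represents no non-zero square, then `ρ(X_Z) = 4` (`Z ∈ M₂(K)`, FILE 4).
[cite: Runge1999EndomorphismRingsAbelianSurfaces, §6 p. 296] [cite: Lange2023AbelianVarietiesComplex, §2.6.3 Exercise (2)] -/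
theorem finrank_neronSeveriGroup_eq_four_of_not_isSimple_of_forall_ne_sq (h₀ : Z ∈ humbertLocus (fun i ↦ (q i : ℂ)))
    (h₁ : Z ∈ humbertLocus (fun i ↦ (q' i : ℂ)))
    (hli : LinearIndependent ℚ ![(fun i ↦ (q i : ℚ)), (fun i ↦ (q' i : ℚ))])
    (hX : ¬ IsSimple (prinPeriod Z : (Fin 2 ⊕ Fin 2 → ℝ) ≃L[ℝ] (Fin 2 → ℂ)))
    (h : ∀ x y δ : ℤ, δ ≠ 0 →
      x ^ 2 * humbertInvariant q + 2 * x * y * humbertPolar q q' + y ^ 2 * humbertInvariant q' ≠ δ ^ 2) :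
    finrank ℤ (neronSeveriGroup (prinPeriod Z : (Fin 2 ⊕ Fin 2 → ℝ) ≃L[ℝ] (Fin 2 → ℂ))) = 4 := by
  rcases finrank_neronSeveriGroup_and_finrank_endAlgRat_of_mem_inter h₀ h₁ hli with ⟨h3, -⟩ | ⟨h4, -⟩
  · exact absurd ((isSimple_iff_forall_discForm_ne_sq h₀ h₁ hli h3).2 h) hX
  · exact h4

end Criterion

/-! ## §4 `ρ(X_Z) = 3`: `End_ℚ(X_Z) = ℚ(α, β)`, and `X_Z` is simple iff `ℚ(α, β)` has no zero-divisors -/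

section EndAlg

/-- On `H_q ∩ H_{q′}` (independent), `ρ(X_Z) = 3 ⟹ dim_ℚ End_ℚ(X_Z) = 4` (the table line `(3, 4)`; the other line is
`(4, 8)`). [cite: BirkenhakeWilhelm2003, §4 Prop. 4.9 (3) (p. 1831)] [cite: Lange2023AbelianVarietiesComplex, §2.6.1 Proposition, table (`g = 2`)] -/
theorem finrank_endAlgRat_eq_four_of_finrank_eq_three (h₀ : Z ∈ humbertLocus (fun i ↦ (q i : ℂ)))
    (h₁ : Z ∈ humbertLocus (fun i ↦ (q' i : ℂ)))
    (hli : LinearIndependent ℚ ![(fun i ↦ (q i : ℚ)), (fun i ↦ (q' i : ℚ))])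
    (h3 : finrank ℤ (neronSeveriGroup (prinPeriod Z : (Fin 2 ⊕ Fin 2 → ℝ) ≃L[ℝ] (Fin 2 → ℂ))) = 3) :
    finrank ℚ (endAlgRat (prinPeriod Z : (Fin 2 ⊕ Fin 2 → ℝ) ≃L[ℝ] (Fin 2 → ℂ))) = 4 := by
  rcases finrank_neronSeveriGroup_and_finrank_endAlgRat_of_mem_inter h₀ h₁ hli with ⟨-, h4⟩ | ⟨h4, -⟩
  · exact h4
  · omega

/-- **`ρ(X_Z) = 3` on `H_q ∩ H_{q′}`: `End_ℚ(X_Z) = ℚ(α, β)`** — simple OR not: the endomorphism algebra of a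
non-CM point of the intersection is Runge's `R ⊗ ℚ = ℚ ⊕ ℚα ⊕ ℚβ ⊕ ℚαβ` (FILE 3 proved the simple branch; here
`dim_ℚ End_ℚ(X_Z) = 4 = dim_ℚ ℚ(α, β)` in both branches). [cite: Runge1999EndomorphismRingsAbelianSurfaces, §6 Thm. 7 and Thm. 9 (pp. 295–296)] [cite: BirkenhakeWilhelm2003, §4 Prop. 4.9 (3) (p. 1831)] -/
theorem endAlgRat_eq_humbertPairAlg_of_finrank_eq_three (h₀ : Z ∈ humbertLocus (fun i ↦ (q i : ℂ)))
    (h₁ : Z ∈ humbertLocus (fun i ↦ (q' i : ℂ)))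
    (hli : LinearIndependent ℚ ![(fun i ↦ (q i : ℚ)), (fun i ↦ (q' i : ℚ))])
    (h3 : finrank ℤ (neronSeveriGroup (prinPeriod Z : (Fin 2 ⊕ Fin 2 → ℝ) ≃L[ℝ] (Fin 2 → ℂ))) = 3) :
    endAlgRat (prinPeriod Z : (Fin 2 ⊕ Fin 2 → ℝ) ≃L[ℝ] (Fin 2 → ℂ)) = humbertPairAlg q q' := by
  symm
  apply Subalgebra.toSubmodule_injective
  apply Submodule.eq_of_le_of_finrank_eq (humbertPairAlg_le_endAlgRat h₀ h₁)
  rw [Subalgebra.finrank_toSubmodule, Subalgebra.finrank_toSubmodule, finrank_humbertPairAlg_of_mem h₀ h₁ hli,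
    finrank_endAlgRat_eq_four_of_finrank_eq_three h₀ h₁ hli h3]

/-- **Simple ⟹ `ℚ(α, β)` has no zero-divisors** (`End_ℚ(X_Z) = ℚ(α, β)` is a skew field: the tree's
`IsSimple.isUnit_or_eq_zero`, Lange Cor. 2.4.26). [cite: Runge1999EndomorphismRingsAbelianSurfaces, §6 Thm. 7 (p. 295: "admissible")] [cite: Lange2023AbelianVarietiesComplex, §2.4.4 Cor. 2.4.26, p. 124] -/
theorem eq_zero_or_eq_zero_of_mul_eq_zero_of_isSimple
    (hX : IsSimple (prinPeriod Z : (Fin 2 ⊕ Fin 2 → ℝ) ≃L[ℝ] (Fin 2 → ℂ)))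
    (h₀ : Z ∈ humbertLocus (fun i ↦ (q i : ℂ))) (h₁ : Z ∈ humbertLocus (fun i ↦ (q' i : ℂ)))
    (hli : LinearIndependent ℚ ![(fun i ↦ (q i : ℚ)), (fun i ↦ (q' i : ℚ))])
    {x y : Matrix (Fin 2 ⊕ Fin 2) (Fin 2 ⊕ Fin 2) ℚ} (hx : x ∈ humbertPairAlg q q') (hy : y ∈ humbertPairAlg q q')
    (hxy : x * y = 0) : x = 0 ∨ y = 0 := by
  rw [← endAlgRat_eq_humbertPairAlg_of_isSimple hX h₀ h₁ hli] at hx hy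
  rcases hX.isUnit_or_eq_zero ⟨x, hx⟩ with hu | h0
  · right
    obtain ⟨u, hu⟩ := hu
    have hprod : (⟨x, hx⟩ : endAlgRat (prinPeriod Z : (Fin 2 ⊕ Fin 2 → ℝ) ≃L[ℝ] (Fin 2 → ℂ))) * ⟨y, hy⟩ = 0 :=
      Subtype.ext hxy
    rw [← hu] at hprod
    have h' := congrArg (fun t ↦ ((u⁻¹ : (endAlgRat (prinPeriod Z : (Fin 2 ⊕ Fin 2 → ℝ) ≃L[ℝ] (Fin 2 → ℂ)))ˣ) :
      endAlgRat (prinPeriod Z : (Fin 2 ⊕ Fin 2 → ℝ) ≃L[ℝ] (Fin 2 → ℂ))) * t) hprod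
    simp only [← mul_assoc, Units.inv_mul, one_mul, mul_zero] at h'
    exact congrArg Subtype.val h'
  · exact Or.inl (congrArg Subtype.val h0)

/-- **Not simple with `ρ(X_Z) = 3` ⟹ `ℚ(α, β)` HAS zero-divisors**: `End_ℚ(X_Z) = ℚ(α, β) ≃ M₂(End_ℚ(Y))` (FILE 3
`exists_isIsogenous_prod_of_not_isSimple`) contains `E₁₁ ≠ 0 ≠ E₂₂` with `E₁₁E₂₂ = 0` — the quaternion algebra
`(Δ(q), −det S_Δ)_ℚ` splits. [cite: Runge1999EndomorphismRingsAbelianSurfaces, §6 Thm. 9 (iii) and p. 296] [cite: Lange2023AbelianVarietiesComplex, §2.4.4 Cor. 2.4.26, p. 124] -/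
theorem exists_mul_eq_zero_of_not_isSimple (hX : ¬ IsSimple (prinPeriod Z : (Fin 2 ⊕ Fin 2 → ℝ) ≃L[ℝ] (Fin 2 → ℂ)))
    (h₀ : Z ∈ humbertLocus (fun i ↦ (q i : ℂ))) (h₁ : Z ∈ humbertLocus (fun i ↦ (q' i : ℂ)))
    (hli : LinearIndependent ℚ ![(fun i ↦ (q i : ℚ)), (fun i ↦ (q' i : ℚ))])
    (h3 : finrank ℤ (neronSeveriGroup (prinPeriod Z : (Fin 2 ⊕ Fin 2 → ℝ) ≃L[ℝ] (Fin 2 → ℂ))) = 3) :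
    ∃ x ∈ humbertPairAlg q q', ∃ y ∈ humbertPairAlg q q', x ≠ 0 ∧ y ≠ 0 ∧ x * y = 0 := by
  obtain ⟨V, hV, hVc, hW, hWc, hrV, -, -, -, ⟨e⟩, -⟩ := exists_isIsogenous_prod_of_not_isSimple hX h₀ h₁ hli
  set A := endAlgRat (subtorusPeriod (prinPeriod Z) V hV hVc) with hA
  haveI : Nonempty (Fin (subRank V)) := ⟨⟨0, by omega⟩⟩
  -- the two diagonal idempotents of `M₂(A)`
  set E₁ : Matrix (Fin 2) (Fin 2) A := !![1, 0; 0, 0] with hE₁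
  set E₂ : Matrix (Fin 2) (Fin 2) A := !![0, 0; 0, 1] with hE₂
  have h12 : E₁ * E₂ = 0 := by
    ext i j
    fin_cases i <;> fin_cases j <;> simp [E₁, E₂, Matrix.mul_apply, Fin.sum_univ_two]
  have hE₁0 : E₁ ≠ 0 := by
    intro h
    have h00 : E₁ 0 0 = (0 : Matrix (Fin 2) (Fin 2) A) 0 0 := by rw [h]
    simp only [E₁, Matrix.of_apply, Matrix.cons_val', Matrix.cons_val_zero, Matrix.cons_val_fin_one,
      Matrix.zero_apply] at h00
    exact one_ne_zero h00
  have hE₂0 : E₂ ≠ 0 := by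
    intro h
    have h11 : E₂ 1 1 = (0 : Matrix (Fin 2) (Fin 2) A) 1 1 := by rw [h]
    simp only [E₂, Matrix.of_apply, Matrix.cons_val', Matrix.cons_val_one, Matrix.cons_val_fin_one,
      Matrix.zero_apply] at h11
    exact one_ne_zero h11
  have hEnd := endAlgRat_eq_humbertPairAlg_of_finrank_eq_three h₀ h₁ hli h3
  refine ⟨(e.symm E₁ : Matrix (Fin 2 ⊕ Fin 2) (Fin 2 ⊕ Fin 2) ℚ), hEnd ▸ (e.symm E₁).2,
    (e.symm E₂ : Matrix (Fin 2 ⊕ Fin 2) (Fin 2 ⊕ Fin 2) ℚ), hEnd ▸ (e.symm E₂).2, ?_, ?_, ?_⟩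
  · intro h
    have h0 : e.symm E₁ = 0 := Subtype.ext h
    exact hE₁0 (e.symm.injective (h0.trans (map_zero e.symm).symm))
  · intro h
    have h0 : e.symm E₂ = 0 := Subtype.ext h
    exact hE₂0 (e.symm.injective (h0.trans (map_zero e.symm).symm))
  · rw [← Subalgebra.coe_mul, ← map_mul, h12, map_zero]
    rfl

/-- **`ρ(X_Z) = 3` on `H_q ∩ H_{q′}`: `X_Z` is simple iff `ℚ(α, β) ≅ (Δ(q), −det S_Δ)_ℚ` has no zero-divisors** (is a
division algebra — Runge's simple QCM points; the non-simple non-CM points all carry the SPLIT algebra: "all non-simple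
QCM-points on `C_R` different from CM-points have the same quaternionic multiplication").
[cite: Runge1999EndomorphismRingsAbelianSurfaces, §6 Thm. 9 (iii) and p. 296] [cite: BirkenhakeWilhelm2003, §4 Prop. 4.9 (3) (p. 1831)] -/
theorem isSimple_iff_forall_mul_eq_zero_of_finrank_eq_three (h₀ : Z ∈ humbertLocus (fun i ↦ (q i : ℂ)))
    (h₁ : Z ∈ humbertLocus (fun i ↦ (q' i : ℂ)))
    (hli : LinearIndependent ℚ ![(fun i ↦ (q i : ℚ)), (fun i ↦ (q' i : ℚ))])
    (h3 : finrank ℤ (neronSeveriGroup (prinPeriod Z : (Fin 2 ⊕ Fin 2 → ℝ) ≃L[ℝ] (Fin 2 → ℂ))) = 3) :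
    IsSimple (prinPeriod Z : (Fin 2 ⊕ Fin 2 → ℝ) ≃L[ℝ] (Fin 2 → ℂ)) ↔
      ∀ x ∈ humbertPairAlg q q', ∀ y ∈ humbertPairAlg q q', x * y = 0 → x = 0 ∨ y = 0 := by
  constructor
  · intro hX x hx y hy hxy
    exact eq_zero_or_eq_zero_of_mul_eq_zero_of_isSimple hX h₀ h₁ hli hx hy hxy
  · intro h
    by_contra hX
    obtain ⟨x, hx, y, hy, hx0, hy0, hxy⟩ := exists_mul_eq_zero_of_not_isSimple hX h₀ h₁ hli h3
    rcases h x hx y hy hxy with h0 | h0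
    · exact hx0 h0
    · exact hy0 h0

/-- **SIMPLICITY ON TWO INDEPENDENT HUMBERT SURFACES, algebra form: `X_Z` is simple iff `ρ(X_Z) = 3` and `ℚ(α, β)`
has no zero-divisors.** [cite: Runge1999EndomorphismRingsAbelianSurfaces, §6 Thm. 7, Thm. 9 (iii), p. 296] [cite: BirkenhakeWilhelm2003, §4 Prop. 4.9 (3) (p. 1831)] -/
theorem isSimple_iff_finrank_eq_three_and_forall_mul_eq_zero (h₀ : Z ∈ humbertLocus (fun i ↦ (q i : ℂ)))
    (h₁ : Z ∈ humbertLocus (fun i ↦ (q' i : ℂ)))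
    (hli : LinearIndependent ℚ ![(fun i ↦ (q i : ℚ)), (fun i ↦ (q' i : ℚ))]) :
    IsSimple (prinPeriod Z : (Fin 2 ⊕ Fin 2 → ℝ) ≃L[ℝ] (Fin 2 → ℂ)) ↔
      finrank ℤ (neronSeveriGroup (prinPeriod Z : (Fin 2 ⊕ Fin 2 → ℝ) ≃L[ℝ] (Fin 2 → ℂ))) = 3 ∧
        ∀ x ∈ humbertPairAlg q q', ∀ y ∈ humbertPairAlg q q', x * y = 0 → x = 0 ∨ y = 0 := by
  constructor
  · intro hX
    have h3 : finrank ℤ (neronSeveriGroup (prinPeriod Z : (Fin 2 ⊕ Fin 2 → ℝ) ≃L[ℝ] (Fin 2 → ℂ))) = 3 := by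
      rcases finrank_neronSeveriGroup_and_finrank_endAlgRat_of_mem_inter h₀ h₁ hli with ⟨h3, -⟩ | ⟨h4, -⟩
      · exact h3
      · exact absurd hX (not_isSimple_of_finrank_neronSeveriGroup_eq_four h4)
    exact ⟨h3, (isSimple_iff_forall_mul_eq_zero_of_finrank_eq_three h₀ h₁ hli h3).1 hX⟩
  · rintro ⟨h3, h⟩
    exact (isSimple_iff_forall_mul_eq_zero_of_finrank_eq_three h₀ h₁ hli h3).2 h

/-- **Geometry ⟹ arithmetic, at a non-CM point of `H_q ∩ H_{q′}`: the discriminant form `S_Δ` represents a non-zero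
square over `ℤ` iff the quaternion algebra `ℚ(α, β) ≅ (Δ(q), −det S_Δ)_ℚ` has zero-divisors** (both say: `X_Z` is not
simple). [cite: Runge1999EndomorphismRingsAbelianSurfaces, §6 p. 296 and Remark 14 (p. 297)] -/
theorem exists_discForm_eq_sq_iff_exists_mul_eq_zero (h₀ : Z ∈ humbertLocus (fun i ↦ (q i : ℂ)))
    (h₁ : Z ∈ humbertLocus (fun i ↦ (q' i : ℂ)))
    (hli : LinearIndependent ℚ ![(fun i ↦ (q i : ℚ)), (fun i ↦ (q' i : ℚ))])
    (h3 : finrank ℤ (neronSeveriGroup (prinPeriod Z : (Fin 2 ⊕ Fin 2 → ℝ) ≃L[ℝ] (Fin 2 → ℂ))) = 3) :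
    (∃ x y δ : ℤ, δ ≠ 0 ∧
        x ^ 2 * humbertInvariant q + 2 * x * y * humbertPolar q q' + y ^ 2 * humbertInvariant q' = δ ^ 2) ↔
      ∃ x ∈ humbertPairAlg q q', ∃ y ∈ humbertPairAlg q q', x ≠ 0 ∧ y ≠ 0 ∧ x * y = 0 := by
  rw [← not_isSimple_iff_exists_discForm_eq_sq h₀ h₁ hli h3]
  constructor
  · intro hX
    exact exists_mul_eq_zero_of_not_isSimple hX h₀ h₁ hli h3
  · rintro ⟨x, hx, y, hy, hx0, hy0, hxy⟩ hX
    rcases eq_zero_or_eq_zero_of_mul_eq_zero_of_isSimple hX h₀ h₁ hli hx hy hxy with h0 | h0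
    · exact hx0 h0
    · exact hy0 h0

end EndAlg

end SiegelModuli

end Literature.AlgebraicGeometry.ModuliOfAbelianVarieties
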